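import Mathlib
import Summits.ValiantsHypothesis.ValiantsHypothesis.Theorems.GrenetZeonPolySizeQPAlgebraCornerThree
import HarnessLib

/-!
# Crux `GrenetZeon.PolySizeQPAlgebra` (stmt-ValiantsHypothesis-8064), line `vbp-slice-dealg` —
# good spaces restrict: a good `c`-space contains good `c'`-spaces (`c' ≤ c`)

Glue for the design of the missing input of the rung `(n, 3)` (`…CornerThree`:
`¬ HasAlgDetRepr per_n n 3 ⟸` a good `4`-space with threshold `6n`).  The hand's census proposes a
bordered `5 × 5` CIRCULANT CORE `circ(a₀,…,a₄) ⊗ J_p` (`n = 5p + r`) — a candidate good FIVE-space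
(brute force over `F_p`, `p ≤ 41`: at most `3` of the `5` core classes die at any point of
`{per circ(a) = 0}`, so `le_rank_hessPer_of_blocks` would give rank `≥ 10(p-1)² > 6n`; the `4 × 4`
core is dead over `ℂ` because `circ(a₀,0,a₂,0)` decomposes).  A good `5`-space restricts to a good
`4`-space (any `4` of its `5` spanning matrices), so it feeds `…CornerThree` by name:

* `goodSpace_restrict` — a good `c`-space with threshold `t` yields a good `c'`-space with threshold
  `t` for every `c' ≤ c` (restrict the spanning family along `Fin.castLE`; extend coefficient
  vectors by zero).
* `not_hasAlgDetRepr_perPoly_le_three_of_goodSpace` — a good `c`-space with `4 ≤ c` and threshold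
  `≥ 6n` at `n ≥ 1` excludes every `(m, s)`-representation of `per_n` with `m ≤ n`, `s ≤ 3`;
  `…_all_large_of_goodSpaces` — the all-large-`n` form.

HONEST FRAMING: glue; no stub of the line is closed; VP ≠ VNP is not moved.
-/

noncomputable section

open MvPolynomial Matrix
open Literature.Computability.AlgebraicComplexity

-- single-conjunct layout `Summits/ValiantsHypothesis/ValiantsHypothesis`: duplicated namespace by design
set_option linter.dupNamespace false

namespace Summit.ValiantsHypothesis.ValiantsHypothesis.Theorems.GrenetZeonPolySizeQPAlgebra

/-- **Good spaces restrict.** If `w₁, …, w_c` are linearly independent matrices on whose span every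
non-zero zero of `per_n` has `rank Hess per_n > t`, then for `c' ≤ c` the first `c'` of them have the
same property (a non-zero combination of `w₁, …, w_{c'}` is a non-zero combination of all of them,
with the remaining coefficients zero). [folklore] -/
theorem goodSpace_restrict {n c c' t : ℕ} (hc : c' ≤ c)
    (hW : ∃ w : Fin c → (Fin n × Fin n → ℂ), LinearIndependent ℂ w ∧
      ∀ a : Fin c → ℂ, a ≠ 0 → eval (∑ i, a i • w i) (perPoly (Fin n) ℂ) = 0 →
        t < (hess0 (transl (∑ i, a i • w i) (perPoly (Fin n) ℂ))).rank) :
    ∃ w : Fin c' → (Fin n × Fin n → ℂ), LinearIndependent ℂ w ∧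
      ∀ a : Fin c' → ℂ, a ≠ 0 → eval (∑ i, a i • w i) (perPoly (Fin n) ℂ) = 0 →
        t < (hess0 (transl (∑ i, a i • w i) (perPoly (Fin n) ℂ))).rank := by
  classical
  obtain ⟨w, hw, hgood⟩ := hW
  set ι : Fin c' → Fin c := Fin.castLE hc with hι
  have hιinj : Function.Injective ι := Fin.castLE_injective hc
  refine ⟨w ∘ ι, hw.comp ι hιinj, fun a ha h0 => ?_⟩
  -- extend `a` by zero along `ι`
  set a' : Fin c → ℂ := Function.extend ι a 0 with ha'
  have ha'ι : ∀ i, a' (ι i) = a i := fun i => by rw [ha', hιinj.extend_apply]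
  have hsum : ∑ j, a' j • w j = ∑ i, a i • (w ∘ ι) i := by
    rw [← Finset.sum_subset (Finset.subset_univ (Finset.univ.image ι))
      (fun j _ hj => by
        have hne : ¬ ∃ i, ι i = j := fun ⟨i, hi⟩ => hj (Finset.mem_image.2 ⟨i, Finset.mem_univ _, hi⟩)
        rw [ha', Function.extend_apply' _ _ _ hne, Pi.zero_apply, zero_smul]),
      Finset.sum_image (fun i _ i' _ h => hιinj h)]
    exact Finset.sum_congr rfl fun i _ => by rw [ha'ι, Function.comp_apply]
  have ha'0 : a' ≠ 0 := by
    intro h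
    apply ha
    funext i
    have := congrFun h (ι i)
    rwa [ha'ι] at this
  have h := hgood a' ha'0 (by rw [hsum]; exact h0)
  rwa [hsum] at h

/-- **The corner `(n, ≤ 3)` from any good `c`-space with `c ≥ 4` and threshold `≥ 6n`** (e.g. a good
`5`-space of threshold `10(p-1)²`, the census design): no `(m, s)`-representation of `per_n` with
`m ≤ n`, `s ≤ 3` (`n ≥ 1`). [cite: MignonRessayre2004, §2] -/
theorem not_hasAlgDetRepr_perPoly_le_three_of_goodSpace {n c t : ℕ} (hn : 1 ≤ n) (hc : 4 ≤ c)
    (ht : 6 * n ≤ t)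
    (hW : ∃ w : Fin c → (Fin n × Fin n → ℂ), LinearIndependent ℂ w ∧
      ∀ a : Fin c → ℂ, a ≠ 0 → eval (∑ i, a i • w i) (perPoly (Fin n) ℂ) = 0 →
        t < (hess0 (transl (∑ i, a i • w i) (perPoly (Fin n) ℂ))).rank)
    {m s : ℕ} (hm : m ≤ n) (hs : s ≤ 3) : ¬ HasAlgDetRepr (perPoly (Fin n) ℂ) m s :=
  not_hasAlgDetRepr_perPoly_of_le_three_of_goodFourSpace hn
    (goodSpace_mono ht (goodSpace_restrict hc hW)) hm hs

/-- **All large `n`:** good `c_n`-spaces (`c_n ≥ 4`) with thresholds `t_n ≥ 6n` for all large `n` empty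
the corner `(m, s) ≤ (n, 3)` of the `c = 1` box of the piece for all large `n`. [folklore] -/
theorem not_hasAlgDetRepr_perPoly_le_three_all_large_of_goodSpaces
    (hW : ∃ n₀ : ℕ, ∀ n ≥ n₀, ∃ c t : ℕ, 4 ≤ c ∧ 6 * n ≤ t ∧
      ∃ w : Fin c → (Fin n × Fin n → ℂ), LinearIndependent ℂ w ∧
        ∀ a : Fin c → ℂ, a ≠ 0 → eval (∑ i, a i • w i) (perPoly (Fin n) ℂ) = 0 →
          t < (hess0 (transl (∑ i, a i • w i) (perPoly (Fin n) ℂ))).rank) :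
    ∃ n₀ : ℕ, ∀ n ≥ n₀, ∀ m s : ℕ, m ≤ n → s ≤ 3 → ¬ HasAlgDetRepr (perPoly (Fin n) ℂ) m s := by
  obtain ⟨n₀, h⟩ := hW
  refine ⟨max n₀ 1, fun n hn m s hm hs => ?_⟩
  obtain ⟨c, t, hc, ht, hgood⟩ := h n (le_of_max_le_left hn)
  exact not_hasAlgDetRepr_perPoly_le_three_of_goodSpace (le_of_max_le_right hn) hc ht hgood hm hs

end Summit.ValiantsHypothesis.ValiantsHypothesis.Theorems.GrenetZeonPolySizeQPAlgebra

end
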